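import Summits.Ventures.GridStability.Lyapunov.StructurePreservingPhase
import HarnessLib

/-!
# GridStability/Lyapunov/StructurePreservingLevelBound — rational lower bounds for the threshold
# level `c⋆(θ, β)` of the structure-preserving energy route, at half-angle-tangent windows

Cell `gridfusion` (LADDER-GRIDFUSION), `plan/PARTITION.md` A25 (rung «G2.b-SP NE39», lead
2026-08-27T00:21:31Z/00:27:46Z: «the generic rational lower-bound lemma for levelBound θ β
(sin θ = 2τ/(1+τ²), arctan τ ≤ τ or finer, Mathlib π bounds)» — lyap-1); seat gridfusion-lyap-1 (g3);
namespace `Summit.Ventures.GridStability.Lyapunov.StructurePreserving` (as `StructurePreservingPhase`).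

The assembly theorem `StructurePreservingRoa.sublevel_subset_regionOfAttraction` (p475989) takes a
window half-width `θ ∈ [0, π/2)` with `|δ₀ᵢ − δ₀ⱼ| ≤ θ` on coupled pairs, a coupling floor `β`, and
any level `c < levelBound θ β = (1 − sin θ)·β·(π/2 − θ)/4` (`levelBound_eq`). An instance file
(NE39, model-2's `Models/NE39SP.lean` + model-4's `bench/data/NE39/sp49/`) has exact unit-circle
equilibrium angles `δ₀ᵢ = 2·arctan tᵢ`, hence a rational half-angle tangent bound `τ` with
`θ = 2·arctan τ`; to choose a RATIONAL `c` in the kernel it needs a rational lower bound of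
`levelBound (2·arctan τ) β`. This file supplies, for `0 ≤ τ < 1`, `0 ≤ β`:

* `sin_two_mul_arctan`, `cos_two_mul_arctan` — `sin θ = 2τ/(1+τ²)`, `cos θ = (1−τ²)/(1+τ²)`
  EXACTLY; `two_mul_arctan_nonneg`, `two_mul_arctan_lt_pi_div_two` — `0 ≤ θ < π/2`;
* `le_levelBound_of_le` — monotonicity: `sin θ ≤ s ≤ 1`, `g ≤ π/2 − θ` ⇒ `(1 − s)·β·g/4 ≤ c⋆`;
* `levelBound_two_mul_arctan_ge_cos` — the trig-free bound
  `β·(1 − τ)³·(1 + τ)/(4·(1 + τ²)²) ≤ c⋆(2·arctan τ, β)` (from `cos θ ≤ π/2 − θ`);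
* `levelBound_two_mul_arctan_ge_pi` — the finer bound
  `β·((1 − τ)²/(1 + τ²))·(1570796/10⁶ − 2τ)/4 ≤ c⋆(2·arctan τ, β)` (from `arctan τ ≤ τ`,
  `arctan_le_self`, and Mathlib's `Real.pi_gt_d6 : 3.141592 < π`), better whenever
  `2τ + cos(2·arctan τ) < 1.570796`, i.e. for every realistic load-flow window.

Pure real analysis (MODELLED/CERTIFIED columns untouched); no definition, no named fact, standard
axioms. Not here: the window lemma `|2·arctan tᵢ − 2·arctan tⱼ| ≤ 2·arctan τ` from
`|(tᵢ − tⱼ)/(1 + tᵢtⱼ)| ≤ τ` (model-2's half-angle kit, announced 2026-08-27T00:34:04Z).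
-/

noncomputable section

open Real

namespace Summit.Ventures.GridStability.Lyapunov.StructurePreserving

/-- `c⋆(θ, β) = (1 − sin θ)·β·(π/2 − θ)/4` for `θ < π/2` (the sector gain's denominator cancels).
[folklore] -/
theorem levelBound_eq {θ : ℝ} (hθ : θ < π / 2) (β : ℝ) :
    levelBound θ β = (1 - Real.sin θ) * β * (π / 2 - θ) / 4 := by
  have hne : π / 2 - θ ≠ 0 := by linarith
  unfold levelBound
  field_simp

/-- **Monotonicity of the threshold in its two transcendental ingredients**: an upper bound
`s ≤ 1` of `sin θ` and a lower bound `g` of `π/2 − θ` give `(1 − s)·β·g/4 ≤ c⋆(θ, β)`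
(`β ≥ 0`, `θ < π/2`). [folklore] -/
theorem le_levelBound_of_le {θ β s g : ℝ} (hθ : θ < π / 2) (hβ : 0 ≤ β) (hs : Real.sin θ ≤ s)
    (hs1 : s ≤ 1) (hg : g ≤ π / 2 - θ) : (1 - s) * β * g / 4 ≤ levelBound θ β := by
  rw [levelBound_eq hθ]
  have h1 : 0 ≤ 1 - s := by linarith
  have h2 : 1 - s ≤ 1 - Real.sin θ := by linarith
  have h3 : 0 ≤ π / 2 - θ := by linarith
  have step1 : (1 - s) * β * g ≤ (1 - s) * β * (π / 2 - θ) :=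
    mul_le_mul_of_nonneg_left hg (mul_nonneg h1 hβ)
  have step2 : (1 - s) * β * (π / 2 - θ) ≤ (1 - Real.sin θ) * β * (π / 2 - θ) := by
    have := mul_le_mul_of_nonneg_right h2 (mul_nonneg hβ h3)
    nlinarith
  linarith

/-- **Half-angle tangent, sine**: `sin(2·arctan τ) = 2τ/(1 + τ²)`. [folklore] -/
theorem sin_two_mul_arctan (τ : ℝ) : Real.sin (2 * Real.arctan τ) = 2 * τ / (1 + τ ^ 2) := by
  have hpos : 0 < 1 + τ ^ 2 := by positivity
  have hs : Real.sqrt (1 + τ ^ 2) * Real.sqrt (1 + τ ^ 2) = 1 + τ ^ 2 :=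
    Real.mul_self_sqrt hpos.le
  rw [Real.sin_two_mul, Real.sin_arctan, Real.cos_arctan,
    show 2 * (τ / Real.sqrt (1 + τ ^ 2)) * (1 / Real.sqrt (1 + τ ^ 2))
      = 2 * τ / (Real.sqrt (1 + τ ^ 2) * Real.sqrt (1 + τ ^ 2)) by ring, hs]

/-- **Half-angle tangent, cosine**: `cos(2·arctan τ) = (1 − τ²)/(1 + τ²)`. [folklore] -/
theorem cos_two_mul_arctan (τ : ℝ) :
    Real.cos (2 * Real.arctan τ) = (1 - τ ^ 2) / (1 + τ ^ 2) := by
  have hpos : 0 < 1 + τ ^ 2 := by positivity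
  have hs : Real.sqrt (1 + τ ^ 2) ^ 2 = 1 + τ ^ 2 := Real.sq_sqrt hpos.le
  have hsq : Real.sqrt (1 + τ ^ 2) ≠ 0 := (Real.sqrt_pos.2 hpos).ne'
  rw [Real.cos_two_mul, Real.cos_arctan, div_pow, hs]
  field_simp
  ring

/-- `0 ≤ 2·arctan τ` for `τ ≥ 0`. [folklore] -/
theorem two_mul_arctan_nonneg {τ : ℝ} (h : 0 ≤ τ) : 0 ≤ 2 * Real.arctan τ := by
  have := Real.arctan_strictMono.monotone h
  rw [Real.arctan_zero] at this
  linarith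

/-- `2·arctan τ < π/2` for `τ < 1` (`arctan 1 = π/4`). [folklore] -/
theorem two_mul_arctan_lt_pi_div_two {τ : ℝ} (h : τ < 1) : 2 * Real.arctan τ < π / 2 := by
  have := Real.arctan_strictMono h
  rw [Real.arctan_one] at this
  linarith

/-- `arctan τ ≤ τ` for `τ ≥ 0` (`x ≤ tan x` on `[0, π/2)` at `x = arctan τ`). [folklore] -/
theorem arctan_le_self {τ : ℝ} (h : 0 ≤ τ) : Real.arctan τ ≤ τ := by
  have h0 : 0 ≤ Real.arctan τ := by
    have := Real.arctan_strictMono.monotone h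
    rwa [Real.arctan_zero] at this
  have h1 := Real.le_tan h0 (Real.arctan_lt_pi_div_two τ)
  rwa [Real.tan_arctan] at h1

/-- `cos θ ≤ π/2 − θ` for `θ ≤ π/2` (`cos θ = sin(π/2 − θ) ≤ π/2 − θ`). [folklore] -/
theorem cos_le_pi_div_two_sub {θ : ℝ} (hθ : θ ≤ π / 2) : Real.cos θ ≤ π / 2 - θ := by
  rw [← Real.sin_pi_div_two_sub]
  exact Real.sin_le (by linarith)

/-- **Trig-free rational lower bound of the threshold at a half-angle-tangent window**: for
`τ < 1`, `β ≥ 0`, `β·(1 − τ)³·(1 + τ)/(4·(1 + τ²)²) ≤ c⋆(2·arctan τ, β)`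
(`sin θ = 2τ/(1+τ²)` exactly and `π/2 − θ ≥ cos θ = (1−τ²)/(1+τ²)`). [folklore] -/
theorem levelBound_two_mul_arctan_ge_cos {τ β : ℝ} (h1 : τ < 1) (hβ : 0 ≤ β) :
    β * (1 - τ) ^ 3 * (1 + τ) / (4 * (1 + τ ^ 2) ^ 2) ≤ levelBound (2 * Real.arctan τ) β := by
  have hθ := two_mul_arctan_lt_pi_div_two h1
  have hpos : 0 < 1 + τ ^ 2 := by positivity
  have hs1 : 2 * τ / (1 + τ ^ 2) ≤ 1 := by
    rw [div_le_one hpos]; nlinarith [sq_nonneg (1 - τ)]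
  have h := le_levelBound_of_le (s := 2 * τ / (1 + τ ^ 2)) (g := (1 - τ ^ 2) / (1 + τ ^ 2)) hθ hβ
    (sin_two_mul_arctan τ).le hs1 (by rw [← cos_two_mul_arctan]; exact cos_le_pi_div_two_sub hθ.le)
  have heq : (1 - 2 * τ / (1 + τ ^ 2)) * β * ((1 - τ ^ 2) / (1 + τ ^ 2)) / 4
      = β * (1 - τ) ^ 3 * (1 + τ) / (4 * (1 + τ ^ 2) ^ 2) := by
    field_simp
    ring
  rw [heq] at h
  exact h

/-- **Finer rational lower bound of the threshold** using `arctan τ ≤ τ` and `3.141592 < π`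
(Mathlib `Real.pi_gt_d6`): for `0 ≤ τ < 1`, `β ≥ 0`,
`β·((1 − τ)²/(1 + τ²))·(1570796/10⁶ − 2τ)/4 ≤ c⋆(2·arctan τ, β)`. [folklore] -/
theorem levelBound_two_mul_arctan_ge_pi {τ β : ℝ} (h0 : 0 ≤ τ) (h1 : τ < 1) (hβ : 0 ≤ β) :
    β * ((1 - τ) ^ 2 / (1 + τ ^ 2)) * (1570796 / 1000000 - 2 * τ) / 4
      ≤ levelBound (2 * Real.arctan τ) β := by
  have hθ := two_mul_arctan_lt_pi_div_two h1
  have hpos : 0 < 1 + τ ^ 2 := by positivity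
  have hs1 : 2 * τ / (1 + τ ^ 2) ≤ 1 := by
    rw [div_le_one hpos]; nlinarith [sq_nonneg (1 - τ)]
  have hg : 1570796 / 1000000 - 2 * τ ≤ π / 2 - 2 * Real.arctan τ := by
    have hπ := Real.pi_gt_d6
    have ha := arctan_le_self h0
    linarith
  have h := le_levelBound_of_le (s := 2 * τ / (1 + τ ^ 2)) (g := 1570796 / 1000000 - 2 * τ) hθ hβ
    (sin_two_mul_arctan τ).le hs1 hg
  have heq : (1 - 2 * τ / (1 + τ ^ 2)) * β * (1570796 / 1000000 - 2 * τ) / 4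
      = β * ((1 - τ) ^ 2 / (1 + τ ^ 2)) * (1570796 / 1000000 - 2 * τ) / 4 := by
    field_simp
    ring
  rw [heq] at h
  exact h

end Summit.Ventures.GridStability.Lyapunov.StructurePreserving

end
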